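import Summits.QuantumFields.BalabanUV.Beta.FP.PureStencilRows
import Summits.QuantumFields.BalabanUV.Beta.FP.PerfectTableFixedPoint
import Summits.QuantumFields.BalabanUV.Beta.FP.PerfectStencilFixedPointSym

/-!
# `BalabanUV.Beta.FP.PerfectTableFixedPointSym` — road «FP» for binder row D1, row **N1-J∞-W** COMPANION (leaf-06 g13, INTENT 1 journal l.31734), FILE 2∕2:
# THE SECOND-ORDER FIXED-POINT EQUATION FOR THE (0.4) LITERAL `JsB12Sym`, `d + 1 = 4`, `Lc ≥ 2` — THE (G) ROW DISCHARGED, THE (S♭) ROW REDUCED TO THE END's OWN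
# S-ROWS, (M)(M₂) AT THEIR OWN VALUES; displayed: the END's `hS0 hSall0` ∕ `hW0 hWall0` VERBATIM, the table letters (M-H)(ShH)(Shmix), and the (S₂) rows of part 3

HONEST DEPENDENCY (page 1, mandatory): continuum YM on T⁴ ⇐ BetaPertH ∧ nine spine estimates (0/9 proved); BetaPertH ⇐ (D1) ∧ (D4) ∧ CAP+tail;
G-an2-4 gates asym, D1 and NE2/3/4.  HONEST FRAMING (cell contract, verbatim): «discharging `BetaPertH` makes Bałaban's UV stability UNCONDITIONAL —
a real constructive-QFT result; it is NOT the continuum limit and NOT the Clay problem.»  ABSOLUTE RULE (cell, verbatim): «No internally-minted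
statement may enter as a cited fact. Every hypothesis is either kernel-proved in this package or a verbatim quotation of a PUBLISHED theorem with page
reference.»  Nothing is cited; no `def`, no `def … : Prop`; no wall binder instantiated; no existing file touched.  NOT IN PRINT; OUR BOOKKEEPING.
WHY (leaf-02 g12's `PerfectTableFixedPoint` p272173 RESIDUAL «(G)(S♭)(S₂) stay HYPOTHESES»; my X2 read C-d1leaf06g13-2 INFO-2∕-3; W-side twin of my lineage's N1-J∞-S (C)
`PerfectStencilFixedPointSym` p271511): the (G) rows of p272173 are typed in EXACTLY the currency C's §1 discharges internally (`d = 3`, `2 ≤ Lc`: the K-slot of record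
`KSlotAssembly.convCKWall_holds` co-dressed by the owner's `SymDressingUnits`), and the (S♭) rows follow from the END's own S-rows and that K-slot (FILE 1).  After this
file the literal's second-order fixed-point equation stands modulo EXACTLY: the END's displayed (CONV-C)-S∕W rows, the table letters (M-H)(ShH)(Shmix), the (S₂) rows (part 3).

## What is proved (`d = 3`; `2 ≤ Lc`, `Odd Lc`; `tabs : SymTables 3 Lc`, free `cΛ cB`, colour count `N`; `K₁ := KPerf Lc (sfStep Lc) (smStep 3 Lc) 1`, `G∞ := coDressKSymAt ρ_c Lc K₁`)
* §1 **`kgRows_holds`** — THE K-SLOT AND THE (G) ROW OF N1-J∞-W HOLD, unconditionally, in ONE currency: `∃ C cK δ θ`, `0 < δ`, `0 ≤ θ < 1`, uniform∕limit∕rate `Decays`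
  rows for `KStepUnit Lc j → K₁` AND for `unitK_j (Gsym Lc j) → G∞` (C's internal block, exported).
* §2 `locStencilFM_weaken` (rate monotonicity of the field–multiplier stencil class, [folklore]; the `LocStencil₂` twin is gan24's `locStencil₂_le_mono`).
* §3 **`slotRows_holds`** — ALL FIVE SLOT-ROW FAMILIES of `limTabOf_unitW_JsB12Sym0_eq` in ONE currency `(m, θ⋆)`, from: §1, FILE 1 at the literal (fed the END's
  `hS0 hSall0 hθS0 hθS1`), leaf-02's `PerfectAveragingTables` rows under (M-H)(ShH)(Shmix) (the `H`∕`mixFF`∕`V` letters taken from the record `tabs.hH`∕`tabs.hmix`∕`tabs.hV`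
  themselves — NO letter hypothesis at a caller's rate), and the displayed (S₂) rows `{C₂ c₂ δ₂ θ₂}`.
* §4 **`limTabOf_unitW_JsB12Sym0_eq_of_rows`** (W-C1): `limTabOf (j ↦ unitW_j (JsB12Sym0 … j).W) = W2SymOfK G∞ Lc S♭∞ (fun μ w => cΛ • tabs.H μ w) S₂inf tabs.mixFF` with the EXPLICIT
  `S♭∞ := limStOf (j ↦ unitS_j (JsB12Sym0 … j).S) − fun κ u => (cΛ·Lc⁸) • S^Λ[lamCoeffK K₁ (mmRead Lc K₁) Lc] tabs.H κ u`; **`wPerfOf_JsB12Sym_eq_dress_of_rows`** (W-C2): the END's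
  object `WPerfOf (sfStep Lc) (smStep 3 Lc) Wt 1 = fun μ y ν y' => dressKSymAt ρ_c Lc (W2SymOfK G∞ Lc S♭∞ (cΛ • tabs.H) S₂inf tabs.mixFF μ y ν y')` under `hWt1` + the END's W-rows
  + S-rows VERBATIM + (M-H)(ShH)(Shmix) + (S₂) (leaf-02's `wPerfOf_JsB12Sym_eq_dress` fed by §3).
* §5 **`pureLimit_eq_cubic_add_border`**: under (ShV)(ShH) + the S-rows, `S♭∞ = fun κ u => (Lc⁴·Lc⁸) • e3OfK Lc G∞ S∞ κ u + (−Lc⁸∕2) • tabs.V κ u` — the Λ-free part of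
  my lineage's (C1) `limStOf_unitS_JsB12Sym0_S_eq` (p271511): the pure limit has the `SpureRecOf` shape.
HONEST: discharges NO (CONV-C) row of the END and NO table letter; the (S₂) rows stay displayed; NOT N2, NOT SDF, NOT D1, NOT `BetaPertH`, NOT continuum, NOT Clay.
Provenance: D1 formalisation swarm LEAF PROVER 06, unit b2b-balaban-beta-d1-formalise-leaf-06 gen 13, 2026-08-21. -/

noncomputable section

open Filter Topology
open Literature.MathematicalPhysics.QuantumFieldTheory
open Literature.MathematicalPhysics.QuantumFieldTheory.Balaban1983to89
open Literature.MathematicalPhysics.QuantumFieldTheory.Balaban1983to89.Beta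
open B12Sec2to5 (l1 l1_nonneg)
open ExpKernelCalculus (MKer Decays BiLoc VertexFamily VertexFamily₂ Zl)
open OneStepResolventKernel (Fib LocStencil decays_mono)
open BalabanCompositeJets (LocStencil₂)
open SecondOrderResponse (W2SymOfK LocStencilFM)
open InterLevelTransport (SLam)
open BalabanStepJets (locStencil_mono)
open BalabanStepJetsSucc (mmRead lamCoeffK)
open BalabanStepW2 (M2Of)
open WilsonVertex2Sym (wsym22)
open AffineAveraging (box toSite)
open AveragingContoursRooted (ctrOff ctrOff_mem_box)
open HessKerDressedLimit (limMKerOf limStOf limTabOf decays_limMKerOf decays_sub_limMKerOf)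
open Summit.QuantumFields.BalabanUV.Beta.HessKerDressedUnits (unitK unitS unitW)
open Summit.QuantumFields.BalabanUV.Beta.SecondOrderUnits (unitM unitS₂ unitM₂)
open Summit.QuantumFields.BalabanUV.Beta.DecayingKernelNeumann (decays_congr_const)
open Summit.QuantumFields.BalabanUV.Beta.GAN24.CombesThomas (sfStep smStep KStepUnit)
open Summit.QuantumFields.BalabanUV.Beta.GAN24.KSlotAssembly (convCKWall_holds)
open Summit.QuantumFields.BalabanUV.Beta.GAN24.WSlotCauchyOfShapes (mul_pow_le_mul_pow locStencil₂_le_mono)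
open Summit.QuantumFields.BalabanUV.Beta.GAN24.StencilSlotOfShapes (locStencil_mono')
open Summit.QuantumFields.BalabanUV.Beta.HessKerConvCKPlug (biLoc_mono')
open Summit.QuantumFields.BalabanUV.Beta.AxialDressingRooted (cPb)
open Summit.QuantumFields.BalabanUV.Beta.SymmetrisedDressingKernel (dressKSymAt coDressKSymAt)
open Summit.QuantumFields.BalabanUV.Beta.FP.SymDressingUnits (decays_coDressKSymAt_explicit decays_rate_coDressKSymAt)
open Summit.QuantumFields.BalabanUV.Beta.FP.PerfectObjectsT (KPerf WPerfOf KPerf_one)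
open Summit.QuantumFields.BalabanUV.Beta.WardLocusRecursive (SrecOf)
open Summit.QuantumFields.BalabanUV.Beta.SpineRooted (SpureRecOf T2RecOf M1Of e3OfK)
open Summit.QuantumFields.BalabanUV.Beta.WardLocusStencils (ffK ffK_inl_inr ffK_inr_inl ffK_inr_inr)
open Summit.QuantumFields.BalabanUV.Beta.SymmetrisedStepJets (SymTables Gsym SpureSymOf JsB12Sym0 JsB12Sym)
open Summit.QuantumFields.BalabanUV.Beta.FP.PerfectAveragingTables (vertexFamily_unitM_M1Of_of_ff vertexFamily_Minf_of_loc vertexFamily_unitM_M1Of_sub_of_ff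
  locStencilFM_unitM₂_M2Of_of_ff locStencilFM_unitM₂_M2Of_sub_of_ff)
open Summit.QuantumFields.BalabanUV.Beta.FP.PerfectTableFixedPoint (limTabOf_unitW_JsB12Sym0_eq wPerfOf_JsB12Sym_eq_dress)
open Summit.QuantumFields.BalabanUV.Beta.FP.PerfectStencilFixedPointSym (JsB12Sym0_S_eq_SrecOf unitK_Gsym_eq limStOf_unitS_JsB12Sym0_S_eq)
open Summit.QuantumFields.BalabanUV.Beta.FP.PureStencilRows (pureRows_of_rows)

namespace Summit.QuantumFields.BalabanUV.Beta.FP.PerfectTableFixedPointSym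

variable {Lc : ℕ} [NeZero Lc]

/-! ## §1 The K-slot and the (G) row hold for `d = 3`, `2 ≤ Lc`, in one currency -/

/-- [our object] **THE K-SLOT AND THE (G) ROW OF N1-J∞-W HOLD** (`d + 1 = 4`, `2 ≤ Lc`; unconditional): ONE currency `(C, cK, δ, θ)` with `0 < δ`, `0 ≤ θ < 1` and —
for `K₁ := KPerf Lc (sfStep Lc) (smStep 3 Lc) 1`, `G∞ := coDressKSymAt ρ_c Lc K₁` (centred root) — the uniform ∕ limit ∕ geometric-rate `Decays` rows of BOTH the unit step
resolvents `KStepUnit Lc j → K₁` AND the literal's unit-rescaled G-slot `unitK_j (Gsym Lc j) → G∞`: the K-slot of record (`KSlotAssembly.convCKWall_holds`, asym1's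
`decays_limMKerOf`∕`decays_sub_limMKerOf` at `KPerf_one`) transported through the co-dressing (`unitK_Gsym_eq`, the owner's `decays_coDressKSymAt_explicit`∕`decays_rate_coDressKSymAt`)
and merged to the rate `δ_K∕4` (`decays_mono`, `mul_pow_le_mul_pow`) — my lineage's C p271511 §1 block, exported. -/
theorem kgRows_holds (hLc : 2 ≤ Lc) :
    ∃ C cK δ θ : ℝ, 0 < δ ∧ 0 ≤ θ ∧ θ < 1 ∧
      (∀ j, Decays (KStepUnit (d := 3) Lc j) C δ) ∧ Decays (KPerf (d := 3) Lc (sfStep Lc) (smStep 3 Lc) 1) C δ ∧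
      (∀ j, Decays (KStepUnit (d := 3) Lc j - KPerf (d := 3) Lc (sfStep Lc) (smStep 3 Lc) 1) (cK * θ ^ j) δ) ∧
      (∀ j, Decays (unitK (sfStep Lc j) (smStep 3 Lc j) (Gsym (d := 3) Lc j)) C δ) ∧
      Decays (coDressKSymAt (toSite (ctrOff (3 + 1) Lc)) Lc (KPerf (d := 3) Lc (sfStep Lc) (smStep 3 Lc) 1)) C δ ∧
      ∀ j, Decays (unitK (sfStep Lc j) (smStep 3 Lc j) (Gsym (d := 3) Lc j) -
        coDressKSymAt (toSite (ctrOff (3 + 1) Lc)) Lc (KPerf (d := 3) Lc (sfStep Lc) (smStep 3 Lc) 1)) (cK * θ ^ j) δ := by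
  have hLc1 : 1 ≤ Lc := le_trans (by norm_num) hLc
  have hr : ctrOff (3 + 1) Lc ∈ box (3 + 1) Lc := ctrOff_mem_box hLc1
  obtain ⟨C, δ, cK, θ, hδ, hθ0, hθ1, hUD, hCD⟩ := convCKWall_holds (Lc := Lc) hLc
  have hK : ∀ j, Decays (KStepUnit (d := 3) Lc j) C δ := hUD
  have hKall : ∀ k j, Decays (KStepUnit (d := 3) Lc (k + j) - KStepUnit (d := 3) Lc k) (cK * θ ^ k) δ := hCD
  set K₁ : MKer (3 + 1) (Fib 3) := KPerf (d := 3) Lc (sfStep Lc) (smStep 3 Lc) 1 with hK₁def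
  have hK₁ : K₁ = limMKerOf (fun j => KStepUnit (d := 3) Lc j) := KPerf_one Lc (sfStep Lc) (smStep 3 Lc)
  have hKinf : Decays K₁ C δ := by rw [hK₁]; exact decays_limMKerOf hK hKall hθ1
  have hKrate : ∀ k, Decays (KStepUnit (d := 3) Lc k - K₁) (cK * θ ^ k) δ := fun k => by rw [hK₁]; exact decays_sub_limMKerOf hKall hθ1 k
  have hC0 : 0 ≤ C := (hK 0).nonneg (Sum.inl 0)
  have hcK0 : 0 ≤ cK := by have h := (hKall 0 0).nonneg (Sum.inl 0); simpa using h
  -- the G-slot through the co-dressing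
  set CG : ℝ := (Fintype.card (Fib 3) : ℝ) * ((Fintype.card (Fib 3) : ℝ) * (cPb 3 Lc δ * C) * Zl (3 + 1) (δ - δ / 2) * cPb 3 Lc (δ / 2))
    * Zl (3 + 1) (δ / 2 - δ / 4) with hCGdef
  set cG : ℝ := ((Fintype.card (Fib 3) : ℝ) * ((Fintype.card (Fib 3) : ℝ) * (cPb 3 Lc δ) * Zl (3 + 1) (δ - δ / 2) * cPb 3 Lc (δ / 2))
    * Zl (3 + 1) (δ / 2 - δ / 4)) * cK with hcGdef
  have hG : ∀ j, Decays (unitK (sfStep Lc j) (smStep 3 Lc j) (Gsym (d := 3) Lc j)) CG (δ / 4) := fun j => by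
    rw [unitK_Gsym_eq]; exact decays_coDressKSymAt_explicit hLc1 hr hδ (hK j)
  have hGinf : Decays (coDressKSymAt (toSite (ctrOff (3 + 1) Lc)) Lc K₁) CG (δ / 4) := decays_coDressKSymAt_explicit hLc1 hr hδ hKinf
  have hGrate : ∀ j, Decays (unitK (sfStep Lc j) (smStep 3 Lc j) (Gsym (d := 3) Lc j) - coDressKSymAt (toSite (ctrOff (3 + 1) Lc)) Lc K₁)
      (cG * θ ^ j) (δ / 4) := fun j => by
    rw [unitK_Gsym_eq]
    exact decays_congr_const (decays_rate_coDressKSymAt hLc1 hr hδ hK hKinf hKrate j) (by rw [hcGdef]; ring)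
  have hCG0 : 0 ≤ CG := (hG 0).nonneg (Sum.inl 0)
  have hcG0 : 0 ≤ cG := by have h := (hGrate 0).nonneg (Sum.inl 0); simpa using h
  -- one currency: rate `δ/4`, constants `max C CG`, `max cK cG`
  have hδ4 : δ / 4 ≤ δ := by linarith
  refine ⟨max C CG, max cK cG, δ / 4, θ, by positivity, hθ0, hθ1, ?_, ?_, ?_, ?_, ?_, ?_⟩
  · exact fun j => decays_mono (hK j) hC0 (le_max_left _ _) hδ4
  · exact decays_mono hKinf hC0 (le_max_left _ _) hδ4
  · exact fun j => decays_mono (hKrate j) (mul_nonneg hcK0 (pow_nonneg hθ0 j))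
      (mul_le_mul_of_nonneg_right (le_max_left _ _) (pow_nonneg hθ0 j)) hδ4
  · exact fun j => decays_mono (hG j) hCG0 (le_max_right _ _) le_rfl
  · exact decays_mono hGinf hCG0 (le_max_right _ _) le_rfl
  · exact fun j => decays_mono (hGrate j) (mul_nonneg hcG0 (pow_nonneg hθ0 j))
      (mul_le_mul_of_nonneg_right (le_max_right _ _) (pow_nonneg hθ0 j)) le_rfl

/-! ## §2 Rate monotonicity of the field–multiplier stencil class -/

section Weaken

variable {d : ℕ}

/-- [folklore] `LocStencilFM` weakens to a smaller nonnegative rate. -/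
theorem locStencilFM_weaken {N : ℕ} {M₂ : Fin (d + 1) → (Fin (d + 1) → ℤ) → Fin (d + 1) → (Fin (d + 1) → ℤ) → MKer (d + 1) (Fib d)} {C δ δ' : ℝ}
    (h : LocStencilFM N M₂ C δ) (hle : δ' ≤ δ) : LocStencilFM N M₂ C δ' := by
  have hC : 0 ≤ C := by
    have h0 := (h 0 0 0 0).nonneg (Sum.inl 0)
    rw [smul_zero, sub_self] at h0
    simpa [l1] using h0
  intro κ u ρ w
  have hb := h κ u ρ w
  refine biLoc_mono' hb (hb.nonneg (Sum.inl 0)) ?_ hle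
  exact mul_le_mul_of_nonneg_left (Real.exp_le_exp.2 (by nlinarith [l1_nonneg (u - (N : ℤ) • w)])) hC

end Weaken

/-! ## §3 All five slot-row families of the fixed-point equation, in one currency -/

section Rows

variable (hOdd : Odd Lc) (N : ℕ) (tabs : SymTables 3 Lc) (cΛ cB : ℝ)

/-- [our object — bookkeeping] **THE FIVE SLOT-ROW FAMILIES OF `limTabOf_unitW_JsB12Sym0_eq` IN ONE CURRENCY** (`d + 1 = 4`, `2 ≤ Lc`, `Odd Lc`).  DISPLAYED: (M-H) `hM1`,
(ShH) `hHff`, (Shmix) `hmixff` (table letters, R-FP-43); the END's S-rows `hS0 hSall0` with `hθS0 hθS1` VERBATIM; the (S₂) rows of the second field tables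
`unitS₂_j (T2RecOf … j) → S₂inf` in their own currency `{C₂ c₂ δ₂ θ₂}` (`0 < δ₂`, `0 ≤ θ₂ < 1`).  SUPPLIED: the K∕G rows (§1), the (S♭) rows (FILE 1 `pureRows_of_rows`
fed `hS0 hSall0` and the record's letters `tabs.hH`∕`tabs.hV`), the (M)(M₂) rows (leaf-02's `PerfectAveragingTables`, rate zero; `tabs.hmix` weakened).  CONCLUSION: one
`(m, θ)` with `0 < m`, `0 ≤ θ < 1` and constants carrying ALL fifteen rows, for the slot limits `G∞`, `S♭∞`, `cΛ • tabs.H`, `S₂inf`, `tabs.mixFF`. -/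
theorem slotRows_holds (hLc : 2 ≤ Lc)
    (hM1 : ∀ (j : ℕ) (ρ : Fin 4) (w : Fin 4 → ℤ), tabs.M j ρ w = M1Of 3 Lc tabs.H cΛ j ρ w)
    (hHff : ∀ μ w, ffK (tabs.H μ w) = tabs.H μ w) (hmixff : ∀ κ u ρ w, ffK (tabs.mixFF κ u ρ w) = tabs.mixFF κ u ρ w)
    {Cs0 cS δS θS : ℝ}
    (hS0 : ∀ j, LocStencil (unitS (sfStep Lc j) (smStep 3 Lc j) (JsB12Sym0 hOdd N tabs cΛ cB j).S) Cs0 δS)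
    (hSall0 : ∀ k j, LocStencil (unitS (sfStep Lc (k + j)) (smStep 3 Lc (k + j)) (JsB12Sym0 hOdd N tabs cΛ cB (k + j)).S -
      unitS (sfStep Lc k) (smStep 3 Lc k) (JsB12Sym0 hOdd N tabs cΛ cB k).S) (cS * θS ^ k) δS)
    (hδS : 0 < δS) (hθS0 : 0 ≤ θS) (hθS1 : θS < 1)
    {S₂inf : Fin 4 → (Fin 4 → ℤ) → Fin 4 → (Fin 4 → ℤ) → MKer 4 (Fib 3)} {C₂ c₂ δ₂ θ₂ : ℝ}
    (hS₂ : ∀ j, LocStencil₂ (unitS₂ (sfStep Lc j) (smStep 3 Lc j) (T2RecOf 3 Lc (Gsym Lc) (SpureSymOf tabs ((Lc : ℝ) ^ 4) (-((Lc : ℝ) ^ 8 / 2)) cΛ) tabs.M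
      ((Lc : ℝ) ^ 8) cB ((8 * (N : ℝ) ^ 2)⁻¹ • wsym22 N) tabs.vh₂S tabs.mixFF j)) C₂ δ₂) (hS₂inf : LocStencil₂ S₂inf C₂ δ₂)
    (hS₂rate : ∀ j, LocStencil₂ (unitS₂ (sfStep Lc j) (smStep 3 Lc j) (T2RecOf 3 Lc (Gsym Lc) (SpureSymOf tabs ((Lc : ℝ) ^ 4) (-((Lc : ℝ) ^ 8 / 2)) cΛ) tabs.M
      ((Lc : ℝ) ^ 8) cB ((8 * (N : ℝ) ^ 2)⁻¹ • wsym22 N) tabs.vh₂S tabs.mixFF j) - S₂inf) (c₂ * θ₂ ^ j) δ₂)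
    (hδ₂ : 0 < δ₂) (hθ₂0 : 0 ≤ θ₂) (hθ₂1 : θ₂ < 1) :
    ∃ C cK Cs cS' CM CM₂ C₂' c₂' m θ : ℝ, 0 < m ∧ 0 ≤ θ ∧ θ < 1 ∧
      (∀ j, Decays (unitK (sfStep Lc j) (smStep 3 Lc j) (Gsym (d := 3) Lc j)) C m) ∧
      Decays (coDressKSymAt (toSite (ctrOff (3 + 1) Lc)) Lc (KPerf (d := 3) Lc (sfStep Lc) (smStep 3 Lc) 1)) C m ∧
      (∀ j, Decays (unitK (sfStep Lc j) (smStep 3 Lc j) (Gsym (d := 3) Lc j) -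
        coDressKSymAt (toSite (ctrOff (3 + 1) Lc)) Lc (KPerf (d := 3) Lc (sfStep Lc) (smStep 3 Lc) 1)) (cK * θ ^ j) m) ∧
      (∀ j, LocStencil (unitS (sfStep Lc j) (smStep 3 Lc j) (SpureSymOf tabs ((Lc : ℝ) ^ 4) (-((Lc : ℝ) ^ 8 / 2)) cΛ j)) Cs m) ∧
      LocStencil (limStOf (fun j => unitS (sfStep Lc j) (smStep 3 Lc j) (JsB12Sym0 hOdd N tabs cΛ cB j).S) -
          fun κ u => (cΛ * (Lc : ℝ) ^ (2 * (3 + 1))) •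
            SLam Lc (lamCoeffK (KPerf (d := 3) Lc (sfStep Lc) (smStep 3 Lc) 1) (mmRead Lc (KPerf (d := 3) Lc (sfStep Lc) (smStep 3 Lc) 1)) Lc) tabs.H κ u) Cs m ∧
      (∀ j, LocStencil (unitS (sfStep Lc j) (smStep 3 Lc j) (SpureSymOf tabs ((Lc : ℝ) ^ 4) (-((Lc : ℝ) ^ 8 / 2)) cΛ j) -
          (limStOf (fun j => unitS (sfStep Lc j) (smStep 3 Lc j) (JsB12Sym0 hOdd N tabs cΛ cB j).S) -
            fun κ u => (cΛ * (Lc : ℝ) ^ (2 * (3 + 1))) •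
              SLam Lc (lamCoeffK (KPerf (d := 3) Lc (sfStep Lc) (smStep 3 Lc) 1) (mmRead Lc (KPerf (d := 3) Lc (sfStep Lc) (smStep 3 Lc) 1)) Lc) tabs.H κ u))
        (cS' * θ ^ j) m) ∧
      (∀ j, VertexFamily (unitM (sfStep Lc j) (smStep 3 Lc j) (tabs.M j)) Lc CM m) ∧ VertexFamily (fun μ w => cΛ • tabs.H μ w) Lc CM m ∧
      (∀ j, VertexFamily (unitM (sfStep Lc j) (smStep 3 Lc j) (tabs.M j) - fun μ w => cΛ • tabs.H μ w) Lc (0 * θ ^ j) m) ∧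
      (∀ j, LocStencil₂ (unitS₂ (sfStep Lc j) (smStep 3 Lc j) (T2RecOf 3 Lc (Gsym Lc) (SpureSymOf tabs ((Lc : ℝ) ^ 4) (-((Lc : ℝ) ^ 8 / 2)) cΛ) tabs.M
        ((Lc : ℝ) ^ 8) cB ((8 * (N : ℝ) ^ 2)⁻¹ • wsym22 N) tabs.vh₂S tabs.mixFF j)) C₂' m) ∧ LocStencil₂ S₂inf C₂' m ∧
      (∀ j, LocStencil₂ (unitS₂ (sfStep Lc j) (smStep 3 Lc j) (T2RecOf 3 Lc (Gsym Lc) (SpureSymOf tabs ((Lc : ℝ) ^ 4) (-((Lc : ℝ) ^ 8 / 2)) cΛ) tabs.M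
        ((Lc : ℝ) ^ 8) cB ((8 * (N : ℝ) ^ 2)⁻¹ • wsym22 N) tabs.vh₂S tabs.mixFF j) - S₂inf) (c₂' * θ ^ j) m) ∧
      (∀ j, LocStencilFM Lc (unitM₂ (sfStep Lc j) (smStep 3 Lc j) (M2Of 3 Lc tabs.mixFF j)) CM₂ m) ∧ LocStencilFM Lc tabs.mixFF CM₂ m ∧
      (∀ j, LocStencilFM Lc (unitM₂ (sfStep Lc j) (smStep 3 Lc j) (M2Of 3 Lc tabs.mixFF j) - tabs.mixFF) (0 * θ ^ j) m) := by
  have hLc1 : 1 ≤ Lc := le_trans (by norm_num) hLc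
  obtain ⟨C, cK, δ, θ, hδ, hθ0, hθ1, hK, hKinf, hKrate, hG, hGinf, hGrate⟩ := kgRows_holds (Lc := Lc) hLc
  -- the (ShH) entry letters and the record's letters
  have hHfm : ∀ μ y x z (α ν : Fin (3 + 1)), tabs.H μ y x z (Sum.inl α) (Sum.inr ν) = 0 := fun μ y x z α ν => by
    rw [← hHff μ y, ffK_inl_inr]
  have hHm : ∀ μ y x z (ν : Fin (3 + 1)) (b : Fib 3), tabs.H μ y x z (Sum.inr ν) b = 0 := fun μ y x z ν b => by
    rcases b with β | ν'
    · rw [← hHff μ y, ffK_inr_inl]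
    · rw [← hHff μ y, ffK_inr_inr]
  obtain ⟨CH, hHδ⟩ := tabs.hH (δ / 2) (by positivity)
  obtain ⟨Cmix, δmix, hδmix, hmix⟩ := tabs.hmix
  -- the common currency
  set m : ℝ := min (min (min (δ / 2 / 2) δS) δ₂) δmix with hm
  have hm0 : 0 < m := lt_min (lt_min (lt_min (by positivity) hδS) hδ₂) hδmix
  have hmδ : m ≤ δ / 2 / 2 := ((min_le_left _ _).trans (min_le_left _ _)).trans (min_le_left _ _)
  have hmS : m ≤ δS := ((min_le_left _ _).trans (min_le_left _ _)).trans (min_le_right _ _)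
  have hm2 : m ≤ δ₂ := (min_le_left _ _).trans (min_le_right _ _)
  have hmmix : m ≤ δmix := min_le_right _ _
  have hmδ' : m ≤ δ := hmδ.trans (by linarith)
  set θ' : ℝ := max (max (max θ θS) (1 / 2)) θ₂ with hθ'
  have hθθ' : θ ≤ θ' := ((le_max_left _ _).trans (le_max_left _ _)).trans (le_max_left _ _)
  have hθbθ' : max (max θ θS) (1 / 2) ≤ θ' := le_max_left _ _
  have hθ₂θ' : θ₂ ≤ θ' := le_max_right _ _
  have hθ'0 : 0 ≤ θ' := hθ0.trans hθθ'
  have hθ'1 : θ' < 1 := max_lt (max_lt (max_lt hθ1 hθS1) (by norm_num)) hθ₂1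
  obtain ⟨CV, hV⟩ := tabs.hV m hm0.le
  -- the (S♭) rows from FILE 1 at the literal's slotted data
  have hS0' : ∀ j, LocStencil (unitS (sfStep Lc j) (smStep 3 Lc j)
      (SrecOf 3 Lc tabs.V tabs.H (Gsym Lc) ((Lc : ℝ) ^ 4) (-((Lc : ℝ) ^ 8 / 2)) cΛ j)) Cs0 δS := fun j => by
    rw [← JsB12Sym0_S_eq_SrecOf hOdd N tabs cΛ cB j]; exact hS0 j
  have hSall0' : ∀ k j, LocStencil (unitS (sfStep Lc (k + j)) (smStep 3 Lc (k + j))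
      (SrecOf 3 Lc tabs.V tabs.H (Gsym Lc) ((Lc : ℝ) ^ 4) (-((Lc : ℝ) ^ 8 / 2)) cΛ (k + j)) -
        unitS (sfStep Lc k) (smStep 3 Lc k) (SrecOf 3 Lc tabs.V tabs.H (Gsym Lc) ((Lc : ℝ) ^ 4) (-((Lc : ℝ) ^ 8 / 2)) cΛ k)) (cS * θS ^ k) δS :=
    fun k j => by
      rw [← JsB12Sym0_S_eq_SrecOf hOdd N tabs cΛ cB (k + j), ← JsB12Sym0_S_eq_SrecOf hOdd N tabs cΛ cB k]; exact hSall0 k j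
  have hSeq : (fun j => unitS (sfStep Lc j) (smStep 3 Lc j) (JsB12Sym0 hOdd N tabs cΛ cB j).S) = fun j =>
      unitS (sfStep Lc j) (smStep 3 Lc j) (SrecOf 3 Lc tabs.V tabs.H (Gsym Lc) ((Lc : ℝ) ^ 4) (-((Lc : ℝ) ^ 8 / 2)) cΛ j) :=
    funext fun j => by rw [JsB12Sym0_S_eq_SrecOf]
  obtain ⟨Cs, cS', hSu, hSi, hSr⟩ := pureRows_of_rows (d := 3) tabs.V tabs.H (Gsym Lc) ((Lc : ℝ) ^ 4) (-((Lc : ℝ) ^ 8 / 2)) cΛ hLc1 hHfm hHm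
    hδ hθ0 hθ1 hK hKinf hKrate hHδ hS0' hSall0' hθS0 hθS1 hm0 hmδ hmS hV
  have hcS' : 0 ≤ cS' := by have h := (hSr 0 0 0).nonneg (Sum.inl 0); simpa using h
  -- signs
  have hC0 : 0 ≤ C := (hK 0).nonneg (Sum.inl 0)
  have hcK0 : 0 ≤ cK := by have h := (hKrate 0).nonneg (Sum.inl 0); simpa using h
  have hC₂0 : 0 ≤ C₂ := by
    have h0 := (hS₂inf 0 0 0 0).nonneg (Sum.inl 0)
    rw [sub_self] at h0
    simpa [l1] using h0
  have hc₂0 : 0 ≤ c₂ := by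
    have h0 := (hS₂rate 0 0 0 0 0).nonneg (Sum.inl 0)
    rw [sub_self] at h0
    simpa [l1] using h0
  -- (M)(M₂) rows at rate zero (leaf-02 FILE 1)
  have hMfun : ∀ j, tabs.M j = M1Of 3 Lc tabs.H cΛ j := fun j => funext fun ρ => funext fun w => hM1 j ρ w
  obtain ⟨CHm, hHm'⟩ := tabs.hH m hm0.le
  refine ⟨C, cK, Cs, cS', |cΛ| * CHm, Cmix, C₂, c₂, m, θ', hm0, hθ'0, hθ'1, ?_, ?_, ?_, ?_, ?_, ?_, ?_, ?_, ?_, ?_, ?_, ?_, ?_, ?_, ?_⟩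
  · exact fun j => decays_mono (hG j) hC0 le_rfl hmδ'
  · exact decays_mono hGinf hC0 le_rfl hmδ'
  · exact fun j => decays_mono (hGrate j) (mul_nonneg hcK0 (pow_nonneg hθ0 j)) (mul_pow_le_mul_pow hcK0 hθ0 hθθ' j) hmδ'
  · exact hSu
  · rw [hSeq]; exact hSi
  · intro j
    rw [hSeq]
    exact locStencil_mono' (hSr j) (mul_pow_le_mul_pow hcS' (hθ0.trans ((le_max_left _ _).trans (le_max_left _ _))) hθbθ' j) le_rfl
  · exact fun j => by rw [hMfun j]; exact vertexFamily_unitM_M1Of_of_ff hHff hHm' cΛ j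
  · exact vertexFamily_Minf_of_loc hHm' cΛ
  · exact fun j => by rw [hMfun j]; exact vertexFamily_unitM_M1Of_sub_of_ff hHff cΛ m θ' j
  · exact fun j => locStencil₂_le_mono (hS₂ j) le_rfl hm2
  · exact locStencil₂_le_mono hS₂inf le_rfl hm2
  · exact fun j => locStencil₂_le_mono (hS₂rate j) (mul_pow_le_mul_pow hc₂0 hθ₂0 hθ₂θ' j) hm2
  · exact locStencilFM_unitM₂_M2Of_of_ff hmixff (locStencilFM_weaken hmix hmmix)
  · exact locStencilFM_weaken hmix hmmix
  · exact locStencilFM_unitM₂_M2Of_sub_of_ff hmixff m θ'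

/-! ## §4 The fixed-point equation and the END's object, (G) discharged and (S♭) reduced -/

/-- [our object] **(W-C1) ROW N1-J∞-W FOR THE (0.4) LITERAL — THE SECOND-ORDER FIXED-POINT EQUATION WITH THE (G) ROW DISCHARGED AND THE (S♭) ROW REDUCED TO THE END's
S-ROWS** (`d + 1 = 4`, `2 ≤ Lc`, `Odd Lc`): under (M-H)(ShH)(Shmix), the END's `hS0 hSall0` (+ `hδS hθS0 hθS1`) VERBATIM and the displayed (S₂) rows `{C₂ c₂ δ₂ θ₂}`,
`limTabOf (j ↦ unitW_j (JsB12Sym0 … j).W) = W2SymOfK G∞ Lc S♭∞ (fun μ w => cΛ • tabs.H μ w) S₂inf tabs.mixFF` with `G∞ := coDressKSymAt ρ_c Lc K₁`,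
`S♭∞ := limStOf (j ↦ unitS_j (JsB12Sym0 … j).S) − fun κ u => (cΛ·Lc^{2(3+1)}) • S^Λ[lamCoeffK K₁ (mmRead Lc K₁) Lc] tabs.H κ u`, `K₁ := KPerf Lc (sfStep Lc) (smStep 3 Lc) 1`
(leaf-02's `limTabOf_unitW_JsB12Sym0_eq` fed by §3).  Discharges no (CONV-C) row and no table letter. -/
theorem limTabOf_unitW_JsB12Sym0_eq_of_rows (hLc : 2 ≤ Lc)
    (hM1 : ∀ (j : ℕ) (ρ : Fin 4) (w : Fin 4 → ℤ), tabs.M j ρ w = M1Of 3 Lc tabs.H cΛ j ρ w)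
    (hHff : ∀ μ w, ffK (tabs.H μ w) = tabs.H μ w) (hmixff : ∀ κ u ρ w, ffK (tabs.mixFF κ u ρ w) = tabs.mixFF κ u ρ w)
    {Cs0 cS δS θS : ℝ}
    (hS0 : ∀ j, LocStencil (unitS (sfStep Lc j) (smStep 3 Lc j) (JsB12Sym0 hOdd N tabs cΛ cB j).S) Cs0 δS)
    (hSall0 : ∀ k j, LocStencil (unitS (sfStep Lc (k + j)) (smStep 3 Lc (k + j)) (JsB12Sym0 hOdd N tabs cΛ cB (k + j)).S -
      unitS (sfStep Lc k) (smStep 3 Lc k) (JsB12Sym0 hOdd N tabs cΛ cB k).S) (cS * θS ^ k) δS)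
    (hδS : 0 < δS) (hθS0 : 0 ≤ θS) (hθS1 : θS < 1)
    {S₂inf : Fin 4 → (Fin 4 → ℤ) → Fin 4 → (Fin 4 → ℤ) → MKer 4 (Fib 3)} {C₂ c₂ δ₂ θ₂ : ℝ}
    (hS₂ : ∀ j, LocStencil₂ (unitS₂ (sfStep Lc j) (smStep 3 Lc j) (T2RecOf 3 Lc (Gsym Lc) (SpureSymOf tabs ((Lc : ℝ) ^ 4) (-((Lc : ℝ) ^ 8 / 2)) cΛ) tabs.M
      ((Lc : ℝ) ^ 8) cB ((8 * (N : ℝ) ^ 2)⁻¹ • wsym22 N) tabs.vh₂S tabs.mixFF j)) C₂ δ₂) (hS₂inf : LocStencil₂ S₂inf C₂ δ₂)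
    (hS₂rate : ∀ j, LocStencil₂ (unitS₂ (sfStep Lc j) (smStep 3 Lc j) (T2RecOf 3 Lc (Gsym Lc) (SpureSymOf tabs ((Lc : ℝ) ^ 4) (-((Lc : ℝ) ^ 8 / 2)) cΛ) tabs.M
      ((Lc : ℝ) ^ 8) cB ((8 * (N : ℝ) ^ 2)⁻¹ • wsym22 N) tabs.vh₂S tabs.mixFF j) - S₂inf) (c₂ * θ₂ ^ j) δ₂)
    (hδ₂ : 0 < δ₂) (hθ₂0 : 0 ≤ θ₂) (hθ₂1 : θ₂ < 1) :
    limTabOf (fun j => unitW (sfStep Lc j) (smStep 3 Lc j) (JsB12Sym0 hOdd N tabs cΛ cB j).W) =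
      W2SymOfK (coDressKSymAt (toSite (ctrOff (3 + 1) Lc)) Lc (KPerf (d := 3) Lc (sfStep Lc) (smStep 3 Lc) 1)) Lc
        (limStOf (fun j => unitS (sfStep Lc j) (smStep 3 Lc j) (JsB12Sym0 hOdd N tabs cΛ cB j).S) -
          fun κ u => (cΛ * (Lc : ℝ) ^ (2 * (3 + 1))) •
            SLam Lc (lamCoeffK (KPerf (d := 3) Lc (sfStep Lc) (smStep 3 Lc) 1) (mmRead Lc (KPerf (d := 3) Lc (sfStep Lc) (smStep 3 Lc) 1)) Lc) tabs.H κ u)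
        (fun μ w => cΛ • tabs.H μ w) S₂inf tabs.mixFF := by
  obtain ⟨C, cK, Cs, cS', CM, CM₂, C₂', c₂', m, θ, hm, hθ0, hθ1, hG, hGinf, hGrate, hSu, hSi, hSr, hM, hMinf, hMrate, hT, hTinf, hTrate,
    hX, hXinf, hXrate⟩ :=
    slotRows_holds hOdd N tabs cΛ cB hLc hM1 hHff hmixff hS0 hSall0 hδS hθS0 hθS1 hS₂ hS₂inf hS₂rate hδ₂ hθ₂0 hθ₂1
  exact limTabOf_unitW_JsB12Sym0_eq hOdd N tabs cΛ cB hG hGinf hGrate hSu hSi hSr hM hMinf hMrate hT hTinf hTrate hX hXinf hXrate hm hθ0 hθ1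

/-- [our object] **(W-C2) THE END's SECOND-ORDER OBJECT IS THE (0.4)-DRESSING OF THE CARRIER AT THE SLOT LIMITS — (G) DISCHARGED, (S♭) REDUCED** (`d + 1 = 4`, `2 ≤ Lc`,
`Odd Lc`): with the END's pin `hWt1` and its W-rows `hW0 hWall0 hδW hθW0 hθW1` and S-rows `hS0 hSall0 hδS hθS0 hθS1` VERBATIM
(`RoadLeftLiteralWard.d1Drift_JsB12Sym_of_sliceLedger_straight_wardTables`), the table letters (M-H)(ShH)(Shmix) and the displayed (S₂) rows,
`WPerfOf (sfStep Lc) (smStep 3 Lc) Wt 1 = fun μ y ν y' => dressKSymAt ρ_c Lc (W2SymOfK G∞ Lc S♭∞ (fun μ w => cΛ • tabs.H μ w) S₂inf tabs.mixFF μ y ν y')`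
(leaf-02's `wPerfOf_JsB12Sym_eq_dress` fed by §3).  Discharges no (CONV-C) row and no table letter. -/
theorem wPerfOf_JsB12Sym_eq_dress_of_rows (hLc : 2 ≤ Lc)
    (Wt : ℕ → ℕ → Fin (3 + 1) → (Fin (3 + 1) → ℤ) → Fin (3 + 1) → (Fin (3 + 1) → ℤ) → MKer (3 + 1) (Fib 3))
    (hWt1 : ∀ j, Wt j 1 = (JsB12Sym hOdd N tabs cΛ cB j).W)
    {Cw0 cW δW θW : ℝ}
    (hW0 : ∀ j, VertexFamily₂ (unitW (sfStep Lc j) (smStep 3 Lc j) (JsB12Sym0 hOdd N tabs cΛ cB j).W) Lc Cw0 δW)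
    (hWall0 : ∀ k j, VertexFamily₂ (unitW (sfStep Lc (k + j)) (smStep 3 Lc (k + j)) (JsB12Sym0 hOdd N tabs cΛ cB (k + j)).W -
      unitW (sfStep Lc k) (smStep 3 Lc k) (JsB12Sym0 hOdd N tabs cΛ cB k).W) Lc (cW * θW ^ k) δW)
    (hδW : 0 < δW) (hθW0 : 0 ≤ θW) (hθW1 : θW < 1)
    (hM1 : ∀ (j : ℕ) (ρ : Fin 4) (w : Fin 4 → ℤ), tabs.M j ρ w = M1Of 3 Lc tabs.H cΛ j ρ w)
    (hHff : ∀ μ w, ffK (tabs.H μ w) = tabs.H μ w) (hmixff : ∀ κ u ρ w, ffK (tabs.mixFF κ u ρ w) = tabs.mixFF κ u ρ w)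
    {Cs0 cS δS θS : ℝ}
    (hS0 : ∀ j, LocStencil (unitS (sfStep Lc j) (smStep 3 Lc j) (JsB12Sym0 hOdd N tabs cΛ cB j).S) Cs0 δS)
    (hSall0 : ∀ k j, LocStencil (unitS (sfStep Lc (k + j)) (smStep 3 Lc (k + j)) (JsB12Sym0 hOdd N tabs cΛ cB (k + j)).S -
      unitS (sfStep Lc k) (smStep 3 Lc k) (JsB12Sym0 hOdd N tabs cΛ cB k).S) (cS * θS ^ k) δS)
    (hδS : 0 < δS) (hθS0 : 0 ≤ θS) (hθS1 : θS < 1)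
    {S₂inf : Fin 4 → (Fin 4 → ℤ) → Fin 4 → (Fin 4 → ℤ) → MKer 4 (Fib 3)} {C₂ c₂ δ₂ θ₂ : ℝ}
    (hS₂ : ∀ j, LocStencil₂ (unitS₂ (sfStep Lc j) (smStep 3 Lc j) (T2RecOf 3 Lc (Gsym Lc) (SpureSymOf tabs ((Lc : ℝ) ^ 4) (-((Lc : ℝ) ^ 8 / 2)) cΛ) tabs.M
      ((Lc : ℝ) ^ 8) cB ((8 * (N : ℝ) ^ 2)⁻¹ • wsym22 N) tabs.vh₂S tabs.mixFF j)) C₂ δ₂) (hS₂inf : LocStencil₂ S₂inf C₂ δ₂)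
    (hS₂rate : ∀ j, LocStencil₂ (unitS₂ (sfStep Lc j) (smStep 3 Lc j) (T2RecOf 3 Lc (Gsym Lc) (SpureSymOf tabs ((Lc : ℝ) ^ 4) (-((Lc : ℝ) ^ 8 / 2)) cΛ) tabs.M
      ((Lc : ℝ) ^ 8) cB ((8 * (N : ℝ) ^ 2)⁻¹ • wsym22 N) tabs.vh₂S tabs.mixFF j) - S₂inf) (c₂ * θ₂ ^ j) δ₂)
    (hδ₂ : 0 < δ₂) (hθ₂0 : 0 ≤ θ₂) (hθ₂1 : θ₂ < 1) :
    WPerfOf (sfStep Lc) (smStep 3 Lc) Wt 1 = fun μ y ν y' =>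
      dressKSymAt (toSite (ctrOff 4 Lc)) Lc
        (W2SymOfK (coDressKSymAt (toSite (ctrOff (3 + 1) Lc)) Lc (KPerf (d := 3) Lc (sfStep Lc) (smStep 3 Lc) 1)) Lc
          (limStOf (fun j => unitS (sfStep Lc j) (smStep 3 Lc j) (JsB12Sym0 hOdd N tabs cΛ cB j).S) -
            fun κ u => (cΛ * (Lc : ℝ) ^ (2 * (3 + 1))) •
              SLam Lc (lamCoeffK (KPerf (d := 3) Lc (sfStep Lc) (smStep 3 Lc) 1) (mmRead Lc (KPerf (d := 3) Lc (sfStep Lc) (smStep 3 Lc) 1)) Lc) tabs.H κ u)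
          (fun μ w => cΛ • tabs.H μ w) S₂inf tabs.mixFF μ y ν y') := by
  obtain ⟨C, cK, Cs, cS', CM, CM₂, C₂', c₂', m, θ, hm, hθ0, hθ1, hG, hGinf, hGrate, hSu, hSi, hSr, hM, hMinf, hMrate, hT, hTinf, hTrate,
    hX, hXinf, hXrate⟩ :=
    slotRows_holds hOdd N tabs cΛ cB hLc hM1 hHff hmixff hS0 hSall0 hδS hθS0 hθS1 hS₂ hS₂inf hS₂rate hδ₂ hθ₂0 hθ₂1
  exact wPerfOf_JsB12Sym_eq_dress hOdd N tabs cΛ cB Wt hWt1 hW0 hWall0 hδW hθW0 hθW1 hG hGinf hGrate hSu hSi hSr hM hMinf hMrate hT hTinf hTrate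
    hX hXinf hXrate hm hθ0 hθ1

/-! ## §5 The pure limit, explicitly: the cubic + border part of the N1-J∞-S fixed point -/

/-- [our object — bookkeeping] **THE PURE LIMIT IS THE CUBIC + BORDER PART OF THE FIXED POINT** (`d + 1 = 4`, `2 ≤ Lc`, `Odd Lc`): under the table SHAPE letters (ShV)
`hVff hVmm`, (ShH) `hHff` and the END's S-rows `hS0 hSall0` (+ `hδS hθS0 hθS1`) — with `S∞ := limStOf (j ↦ unitS_j (JsB12Sym0 … j).S)`, `K₁ := KPerf Lc (sfStep Lc) (smStep 3 Lc) 1`,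
`G∞ := coDressKSymAt ρ_c Lc K₁` —
`S∞ − (cΛ·Lc⁸) • S^Λ[lamCoeffK K₁ (mmRead Lc K₁) Lc] tabs.H = fun κ u => (Lc⁴·Lc⁸) • e3OfK Lc G∞ S∞ κ u + (−Lc⁸∕2) • tabs.V κ u`: the S-slot limit `S♭∞` of §4 is the
Λ-free part of my lineage's (C1) `PerfectStencilFixedPointSym.limStOf_unitS_JsB12Sym0_S_eq` — the shape of `SpureRecOf` at the limit.  Discharges nothing. -/
theorem pureLimit_eq_cubic_add_border (hLc : 2 ≤ Lc)
    (hVff : ∀ κ u x y (α β : Fin (3 + 1)), tabs.V κ u x y (Sum.inl α) (Sum.inl β) = 0)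
    (hVmm : ∀ κ u x y (μ ν : Fin (3 + 1)), tabs.V κ u x y (Sum.inr μ) (Sum.inr ν) = 0)
    (hHff : ∀ μ w, ffK (tabs.H μ w) = tabs.H μ w)
    {Cs0 cS δS θS : ℝ}
    (hS0 : ∀ j, LocStencil (unitS (sfStep Lc j) (smStep 3 Lc j) (JsB12Sym0 hOdd N tabs cΛ cB j).S) Cs0 δS)
    (hSall0 : ∀ k j, LocStencil (unitS (sfStep Lc (k + j)) (smStep 3 Lc (k + j)) (JsB12Sym0 hOdd N tabs cΛ cB (k + j)).S -
      unitS (sfStep Lc k) (smStep 3 Lc k) (JsB12Sym0 hOdd N tabs cΛ cB k).S) (cS * θS ^ k) δS)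
    (hδS : 0 < δS) (hθS0 : 0 ≤ θS) (hθS1 : θS < 1) :
    (limStOf (fun j => unitS (sfStep Lc j) (smStep 3 Lc j) (JsB12Sym0 hOdd N tabs cΛ cB j).S) -
        fun κ u => (cΛ * (Lc : ℝ) ^ (2 * (3 + 1))) •
          SLam Lc (lamCoeffK (KPerf (d := 3) Lc (sfStep Lc) (smStep 3 Lc) 1) (mmRead Lc (KPerf (d := 3) Lc (sfStep Lc) (smStep 3 Lc) 1)) Lc) tabs.H κ u) =
      fun κ u =>
        ((Lc : ℝ) ^ 4 * (Lc : ℝ) ^ (2 * (3 + 1))) •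
            e3OfK Lc (coDressKSymAt (toSite (ctrOff (3 + 1) Lc)) Lc (KPerf (d := 3) Lc (sfStep Lc) (smStep 3 Lc) 1))
              (limStOf (fun j => unitS (sfStep Lc j) (smStep 3 Lc j) (JsB12Sym0 hOdd N tabs cΛ cB j).S)) κ u +
          (-((Lc : ℝ) ^ 8 / 2)) • tabs.V κ u := by
  have hHfm : ∀ μ y x z (α ν : Fin (3 + 1)), tabs.H μ y x z (Sum.inl α) (Sum.inr ν) = 0 := fun μ y x z α ν => by
    rw [← hHff μ y, ffK_inl_inr]
  have hHm : ∀ μ y x z (ν : Fin (3 + 1)) (b : Fib 3), tabs.H μ y x z (Sum.inr ν) b = 0 := fun μ y x z ν b => by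
    rcases b with β | ν'
    · rw [← hHff μ y, ffK_inr_inl]
    · rw [← hHff μ y, ffK_inr_inr]
  have hC1 := limStOf_unitS_JsB12Sym0_S_eq hLc hOdd N tabs cΛ cB hVff hVmm hHfm hHm hS0 hSall0 hδS hθS0 hθS1
  funext κ u
  rw [Pi.sub_apply, Pi.sub_apply]
  have h := congrFun (congrFun hC1 κ) u
  rw [h, add_sub_cancel_right]

end Rows

end Summit.QuantumFields.BalabanUV.Beta.FP.PerfectTableFixedPointSym

end
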